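import Literature.Analysis.FluidPDE.ESSLocalHolderBlowupPressure
import HarnessLib

/-!
# ESS Thm. 1.4 (`ess_local_holder`): global integrability of the blow-up limit, far-field smallness
# (Seregin 2014, §6.6, (6.6.9); ESS 2003, §3 (3.21)–(3.22))

Analysis/FluidPDE proofs-only file (theorems only: no definitions, no named facts) in the
bottom-up discharge of `Literature.Analysis.FluidPDE.ess_local_holder` (L. Escauriaza,
G. Seregin, V. Šverák, Russ. Math. Surveys 58:2 (2003) 211–250, Thm. 1.4). With the pressure of
the blow-up limit identified slice-wise with the Riesz pressure
(`ae_pressure_ae_eq_rieszPressure`), the limit pair `(w, π)` satisfies G. Seregin, *Lecture Notes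
on Regularity Theory for the Navier–Stokes Equations* (2014), (6.6.9):
`∫_{-T}^0 ∫_{ℝ³} (|w|³ + |π|^{3/2}) < ∞` for every `T > 0`, whence the far-field smallness
`∫_{-T}^0 ∫_{|x|>R} (|w|³ + |π|^{3/2}) → 0` (`R → ∞`) that starts the spatial-decay / backward
uniqueness part of the argument (ESS 2003, §3 (3.22); Seregin 2014, p. 129, "(6.6.10)"):

* `aestronglyMeasurable_slab_of_forall_cylinder` — measurability on the slabs `]-T, 0[ × ℝ³` from
  measurability on the cylinders `Q(a)`;
* `lintegral_slab_cube_add_pressure_le` — (6.6.9) with the explicit bound `T (M + P⋆)`;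
* `exists_farField_small` — for every `T, ε > 0` there is `R > 0` with
  `∫_{]-T,0[ × {|x| > R}} (|w|³ + |π|^{3/2}) < ε`.

Nothing accepted is restated or changed; no `sorry`.

## References

* L. Escauriaza, G. Seregin, V. Šverák, Russ. Math. Surveys 58:2 (2003) 211–250: §3 (3.21)–(3.22).
  [`EscauriazaSereginSverak2003`]
* G. Seregin, *Lecture Notes on Regularity Theory for the Navier–Stokes Equations*, World
  Scientific (2014), §6.6, (6.6.9)–(6.6.10), p. 129. [`Seregin2014`]
-/

noncomputable section

open MeasureTheory Set Function Filter Topology TopologicalSpace Metric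
open scoped NNReal ENNReal InnerProductSpace RealInnerProductSpace

namespace Literature.Analysis.FluidPDE

section FarField

variable {w : ℝ → EuclideanSpace ℝ (Fin 3) → EuclideanSpace ℝ (Fin 3)}
  {π : ℝ → EuclideanSpace ℝ (Fin 3) → ℝ}

/-- The slab `]-T, 0[ × ℝ³` is the union of the products `]-T, 0[ × B(0, n+1)`. [folklore] -/
theorem slab_eq_iUnion (T : ℝ) :
    Ioo (-T) 0 ×ˢ (univ : Set (EuclideanSpace ℝ (Fin 3))) =
      ⋃ n : ℕ, Ioo (-T) 0 ×ˢ ball (0 : EuclideanSpace ℝ (Fin 3)) ((n : ℝ) + 1) := by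
  rw [← prod_iUnion, iUnion_ball_nat_succ]

/-- **Measurability on slabs from measurability on the cylinders `Q(a)`.** [folklore] -/
theorem aestronglyMeasurable_slab_of_forall_cylinder {X : Type*} [TopologicalSpace X]
    [TopologicalSpace.PseudoMetrizableSpace X] {F : ℝ × EuclideanSpace ℝ (Fin 3) → X}
    (hF : ∀ a : ℝ, 0 < a → AEStronglyMeasurable F
      (volume.restrict (parabolicCylinder a (0 : ℝ × EuclideanSpace ℝ (Fin 3)))))
    {T : ℝ} (hT : 0 < T) :
    AEStronglyMeasurable F (volume.restrict (Ioo (-T) 0 ×ˢ (univ : Set (EuclideanSpace ℝ (Fin 3))))) := by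
  obtain ⟨n₀, hn₀⟩ := exists_nat_ge T
  rw [slab_eq_iUnion, aestronglyMeasurable_iUnion_iff]
  intro n
  set N : ℕ := max n n₀ with hN
  have hsub : Ioo (-T) 0 ×ˢ ball (0 : EuclideanSpace ℝ (Fin 3)) ((n : ℝ) + 1) ⊆
      parabolicCylinder ((N : ℝ) + 1) (0 : ℝ × EuclideanSpace ℝ (Fin 3)) := by
    rw [SuitableCompactness.parabolicCylinder_zero]
    refine prod_mono (Ioo_subset_Ioo ?_ le_rfl) (ball_subset_ball ?_)
    · have h1 : (n₀ : ℝ) ≤ N := by exact_mod_cast le_max_right _ _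
      nlinarith [(N.cast_nonneg : (0 : ℝ) ≤ N)]
    · have h1 : (n : ℝ) ≤ N := by exact_mod_cast le_max_left _ _
      linarith
  exact (hF ((N : ℝ) + 1) (by positivity)).mono_measure (Measure.restrict_mono hsub le_rfl)

/-- **Global integrability of the blow-up limit** (Seregin 2014, (6.6.9)): with
`P⋆ = (c_{3/2} M^{2/3})^{3/2}`, `∫_{]-T,0[ × ℝ³} (|w|³ + |π|^{3/2}) ≤ T (M + P⋆)` for every `T > 0`
(Tonelli, the sliced bound `∫ |w(s)|³ ≤ M` and `‖π(s)‖_{3/2} = ‖Π[w(s)]‖_{3/2} ≤ c_{3/2} ‖w(s)‖₃²`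
from `ae_pressure_ae_eq_rieszPressure`). [cite: Seregin2014, §6.6 (6.6.9)] [cite: EscauriazaSereginSverak2003, §3 (3.21)] -/
theorem lintegral_slab_cube_add_pressure_le {M D : ℝ≥0}
    (hw : ∀ a : ℝ, 0 < a → IsSuitableWeakSolutionInBall a (0 : ℝ × EuclideanSpace ℝ (Fin 3)) w π)
    (hM : ∀ a : ℝ, 0 < a → ∀ᵐ s ∂(volume.restrict (Ioo (-a ^ 2) 0)),
      ∫⁻ y in ball (0 : EuclideanSpace ℝ (Fin 3)) a, ‖w s y‖ₑ ^ (3 : ℕ) ≤ M)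
    (hD : ∀ a : ℝ, 0 < a → cknD a (0 : ℝ × EuclideanSpace ℝ (Fin 3)) π ≤ D) {T : ℝ} (hT : 0 < T) :
    ∫⁻ z in Ioo (-T) 0 ×ˢ (univ : Set (EuclideanSpace ℝ (Fin 3))),
        (‖w z.1 z.2‖ₑ ^ (3 : ℕ) + ‖π z.1 z.2‖ₑ ^ (3 / 2 : ℝ)) ≤
      ENNReal.ofReal T * ((M : ℝ≥0∞) +
        ((steinConstThreeHalves : ℝ≥0∞) * ((M : ℝ≥0∞) ^ (1 / 3 : ℝ)) ^ 2) ^ (3 / 2 : ℝ)) := by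
  set P : ℝ≥0∞ := ((steinConstThreeHalves : ℝ≥0∞) * ((M : ℝ≥0∞) ^ (1 / 3 : ℝ)) ^ 2) ^ (3 / 2 : ℝ) with hP
  have hwm : AEStronglyMeasurable (uncurry w)
      (volume.restrict (Ioo (-T) 0 ×ˢ (univ : Set (EuclideanSpace ℝ (Fin 3))))) :=
    aestronglyMeasurable_slab_of_forall_cylinder
      (fun a ha => (hw a ha).1.distributional.1.aestronglyMeasurable) hT
  have hπm : AEStronglyMeasurable (uncurry π)
      (volume.restrict (Ioo (-T) 0 ×ˢ (univ : Set (EuclideanSpace ℝ (Fin 3))))) :=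
    aestronglyMeasurable_slab_of_forall_cylinder
      (fun a ha => (hw a ha).1.distributional.2.2.1.aestronglyMeasurable) hT
  have hprod : (volume.restrict (Ioo (-T) 0 ×ˢ (univ : Set (EuclideanSpace ℝ (Fin 3)))) :
      Measure (ℝ × EuclideanSpace ℝ (Fin 3))) = (volume.restrict (Ioo (-T) 0)).prod volume := by
    rw [FunctionSpaces.AubinLions.volume_restrict_prod, Measure.restrict_univ]
  have hmeas : AEMeasurable (fun z : ℝ × EuclideanSpace ℝ (Fin 3) =>
      ‖w z.1 z.2‖ₑ ^ (3 : ℕ) + ‖π z.1 z.2‖ₑ ^ (3 / 2 : ℝ)) ((volume.restrict (Ioo (-T) 0)).prod volume) := by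
    rw [← hprod]
    exact (hwm.enorm.pow_const _).add (hπm.enorm.pow_const _)
  rw [hprod, lintegral_prod _ hmeas]
  -- the slice bounds
  have hsl := ae_restrict_of_ae_restrict_of_subset (Ioo_subset_Iio_self : Ioo (-T) 0 ⊆ Iio 0)
    (ae_pressure_ae_eq_rieszPressure hw hM hD)
  have hbound : ∀ᵐ s ∂(volume.restrict (Ioo (-T) 0)),
      ∫⁻ y, (‖w s y‖ₑ ^ (3 : ℕ) + ‖π s y‖ₑ ^ (3 / 2 : ℝ)) ≤ (M : ℝ≥0∞) + P := by
    filter_upwards [hsl] with s hs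
    obtain ⟨hw3, hs3, hπs⟩ := hs
    rw [lintegral_add_left' (hw3.1.enorm.pow_const _)]
    refine add_le_add hs3 ?_
    have e1 : ∫⁻ y, ‖π s y‖ₑ ^ (3 / 2 : ℝ) = ∫⁻ y, ‖rieszPressure (w s) y‖ₑ ^ (3 / 2 : ℝ) :=
      lintegral_congr_ae (hπs.mono fun y hy => by
        show ‖π s y‖ₑ ^ (3 / 2 : ℝ) = ‖rieszPressure (w s) y‖ₑ ^ (3 / 2 : ℝ)
        rw [hy])
    rw [e1]
    have h2 := eLpNorm_rieszPressure_le hw3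
    rw [eLpNorm_eq_lintegral_rpow_enorm_toReal (by norm_num)
      (ENNReal.div_ne_top ENNReal.ofNat_ne_top two_ne_zero)] at h2
    have e32 : ((3 / 2 : ℝ≥0∞)).toReal = (3 / 2 : ℝ) := by
      rw [ENNReal.toReal_div, ENNReal.toReal_ofNat, ENNReal.toReal_ofNat]
    rw [e32] at h2
    have h3 : eLpNorm (w s) 3 volume ≤ (M : ℝ≥0∞) ^ (1 / 3 : ℝ) := by
      rw [eLpNorm_three_eq_lintegral_cube_rpow]
      exact ENNReal.rpow_le_rpow hs3 (by norm_num)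
    have h4 : (∫⁻ y, ‖rieszPressure (w s) y‖ₑ ^ (3 / 2 : ℝ)) ^ (1 / (3 / 2 : ℝ)) ≤
        (steinConstThreeHalves : ℝ≥0∞) * ((M : ℝ≥0∞) ^ (1 / 3 : ℝ)) ^ 2 :=
      h2.trans (mul_le_mul' le_rfl (pow_le_pow_left' h3 2))
    have h5 := ENNReal.rpow_le_rpow h4 (by norm_num : (0 : ℝ) ≤ 3 / 2)
    rwa [← ENNReal.rpow_mul, show (1 / (3 / 2 : ℝ)) * (3 / 2) = 1 by norm_num, ENNReal.rpow_one] at h5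
  calc ∫⁻ s in Ioo (-T) 0, ∫⁻ y, (‖w (s, y).1 (s, y).2‖ₑ ^ (3 : ℕ) + ‖π (s, y).1 (s, y).2‖ₑ ^ (3 / 2 : ℝ))
      ≤ ∫⁻ s in Ioo (-T) 0, ((M : ℝ≥0∞) + P) := lintegral_mono_ae hbound
    _ = ENNReal.ofReal T * ((M : ℝ≥0∞) + P) := by
        rw [lintegral_const, Measure.restrict_apply_univ, Real.volume_Ioo, sub_neg_eq_add, zero_add, mul_comm]

/-- **Far-field smallness** (Seregin 2014, towards (6.6.10); ESS 2003, (3.22)): for every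
`T, ε > 0` there is `R > 0` with `∫_{]-T,0[ × {|x| > R}} (|w|³ + |π|^{3/2}) < ε` (dominated
convergence from (6.6.9)). [cite: Seregin2014, §6.6 (6.6.9)–(6.6.10)] [cite: EscauriazaSereginSverak2003, §3 (3.22)] -/
theorem exists_farField_small {M D : ℝ≥0}
    (hw : ∀ a : ℝ, 0 < a → IsSuitableWeakSolutionInBall a (0 : ℝ × EuclideanSpace ℝ (Fin 3)) w π)
    (hM : ∀ a : ℝ, 0 < a → ∀ᵐ s ∂(volume.restrict (Ioo (-a ^ 2) 0)),
      ∫⁻ y in ball (0 : EuclideanSpace ℝ (Fin 3)) a, ‖w s y‖ₑ ^ (3 : ℕ) ≤ M)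
    (hD : ∀ a : ℝ, 0 < a → cknD a (0 : ℝ × EuclideanSpace ℝ (Fin 3)) π ≤ D) {T : ℝ} (hT : 0 < T)
    {ε : ℝ≥0∞} (hε : 0 < ε) :
    ∃ R : ℝ, 0 < R ∧
      ∫⁻ z in Ioo (-T) 0 ×ˢ (closedBall (0 : EuclideanSpace ℝ (Fin 3)) R)ᶜ,
        (‖w z.1 z.2‖ₑ ^ (3 : ℕ) + ‖π z.1 z.2‖ₑ ^ (3 / 2 : ℝ)) < ε := by
  set S : Set (ℝ × EuclideanSpace ℝ (Fin 3)) := Ioo (-T) 0 ×ˢ (univ : Set (EuclideanSpace ℝ (Fin 3))) with hS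
  set μ : Measure (ℝ × EuclideanSpace ℝ (Fin 3)) := volume.restrict S with hμ
  set f : ℝ × EuclideanSpace ℝ (Fin 3) → ℝ≥0∞ := fun z =>
    ‖w z.1 z.2‖ₑ ^ (3 : ℕ) + ‖π z.1 z.2‖ₑ ^ (3 / 2 : ℝ) with hf
  have hwm : AEStronglyMeasurable (uncurry w) μ :=
    aestronglyMeasurable_slab_of_forall_cylinder
      (fun a ha => (hw a ha).1.distributional.1.aestronglyMeasurable) hT
  have hπm : AEStronglyMeasurable (uncurry π) μ :=
    aestronglyMeasurable_slab_of_forall_cylinder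
      (fun a ha => (hw a ha).1.distributional.2.2.1.aestronglyMeasurable) hT
  have hfm : AEMeasurable f μ := (hwm.enorm.pow_const _).add (hπm.enorm.pow_const _)
  have hfin : ∫⁻ z, f z ∂μ ≠ ∞ :=
    ne_top_of_le_ne_top (ENNReal.mul_ne_top ENNReal.ofReal_ne_top (ENNReal.add_ne_top.2
      ⟨ENNReal.coe_ne_top, ENNReal.rpow_ne_top_of_nonneg (by norm_num) (ENNReal.mul_ne_top ENNReal.coe_ne_top
        (ENNReal.pow_ne_top (ENNReal.rpow_ne_top_of_nonneg (by norm_num) ENNReal.coe_ne_top)))⟩))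
      (lintegral_slab_cube_add_pressure_le hw hM hD hT)
  -- the truncations `F_n = 1_{|x| > n} f`
  set C : ℕ → Set (ℝ × EuclideanSpace ℝ (Fin 3)) := fun n =>
    (univ : Set ℝ) ×ˢ (closedBall (0 : EuclideanSpace ℝ (Fin 3)) n)ᶜ with hC
  have hCm : ∀ n, MeasurableSet (C n) := fun n =>
    MeasurableSet.univ.prod measurableSet_closedBall.compl
  set F : ℕ → ℝ × EuclideanSpace ℝ (Fin 3) → ℝ≥0∞ := fun n => (C n).indicator f with hF
  have hFm : ∀ n, AEMeasurable (F n) μ := fun n => hfm.indicator (hCm n)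
  have hFle : ∀ n, F n ≤ᵐ[μ] f := fun n => Eventually.of_forall fun z => indicator_le_self _ _ z
  have hFlim : ∀ᵐ z ∂μ, Tendsto (fun n => F n z) atTop (𝓝 0) := by
    refine Eventually.of_forall fun z => ?_
    obtain ⟨n₀, hn₀⟩ := exists_nat_ge ‖z.2‖
    refine tendsto_atTop_of_eventually_const (i₀ := n₀) fun n hn => ?_
    rw [hF]
    dsimp only
    rw [indicator_of_notMem]
    simp only [hC, mem_prod, mem_univ, mem_compl_iff, mem_closedBall, dist_zero_right, true_and, not_not]
    exact hn₀.trans (by exact_mod_cast hn)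
  have hlim := tendsto_lintegral_of_dominated_convergence' f hFm hFle hfin hFlim
  rw [lintegral_zero] at hlim
  obtain ⟨n, hn⟩ := (hlim.eventually (gt_mem_nhds hε)).exists_forall_of_atTop
  refine ⟨(n : ℝ) + 1, by positivity, ?_⟩
  have h1 := hn (n + 1) (Nat.le_succ n)
  -- `∫ F_{n+1} dμ = ∫_{]-T,0[ × {|x| > n+1}} f`
  have e : ∫⁻ z, F (n + 1) z ∂μ = ∫⁻ z in Ioo (-T) 0 ×ˢ (closedBall (0 : EuclideanSpace ℝ (Fin 3)) ((n : ℝ) + 1))ᶜ,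
      f z := by
    rw [hF]
    dsimp only
    rw [lintegral_indicator (hCm _), hμ, Measure.restrict_restrict (hCm _)]
    congr 1
    rw [hC, hS]
    dsimp only
    rw [prod_inter_prod, univ_inter, inter_univ]
    push_cast
    rfl
  rw [e] at h1
  exact h1

end FarField

end Literature.Analysis.FluidPDE
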